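import Summits.ValiantsHypothesis.ValiantsHypothesis.Theorems.BarrierLeverKFoldDetNoGo

/-!
# Route BarrierLever — item `PartitionMinorsHitByVP` (stmt-ValiantsHypothesis-19717):
# NO-GO for READ-`k` DETERMINANTS (symbolic matrices `1 + Σ_v X_v A_v` with `rank A_v ≤ k`)

Helper file (`--supports stmt-ValiantsHypothesis-19717`; cell valiant-natproofs, rung V4, 𝒟-side door
(c); prover seat val-np-p6 gen 7). Definition-free; cone-free (pure linear algebra + `MvPolynomial`).

A READ-`k` DETERMINANTAL WITNESS is `f = det(1 + Σ_v X_v · P_v Q_v)` with `P_v ∈ ℂ^{m×k}`,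
`Q_v ∈ ℂ^{k×m}` (`v` over the `h+h` variables `x_a, y_c`): every variable enters through a matrix of
rank `≤ k`. This covers `det(C + Σ_v X_v A_v)` with `C` invertible and `rank A_v ≤ k` (multiply by
`C⁻¹`), in particular every algebraic branching program in which each variable labels at most `k` edges
(READ-`k` ABPs of any width, any order, non-oblivious: `f = det(1 − N)`, `N` the nilpotent weighted
adjacency matrix, `A_v` = the `≤ k` edges carrying `X_v`).

* `sum_smul_lowRank_eq`, `readK_eq_kfold` — `det(1 + Σ_v X_v P_v Q_v) = det(1 + D·(𝐐𝐏))` with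
  `D = diag(X_v : (v,κ) ∈ [h+h]×[k])`, by Sylvester's `det(1 + AB) = det(1 + BA)`
  (`Matrix.det_one_add_mul_comm`): a read-`k` determinant IS a `k`-fold determinantal witness
  for the table `𝐐𝐏` re-indexed by `Fin ((h+h)·k)`.
* **`readK_det_dead_layout`** (and `readK_det_dead_layout'` for an invertible constant part `C`,
  `det_readK_absorb`) — if `(k|T|)² + 1 < 2^|T| ≤ h + 1` for a block `T ⊆ Fin h`, ONE
  injective layout (rows of size `≤ 1`, the subsets of `T` as columns) has a singular layout matrix for
  EVERY read-`k` determinantal witness, whatever `m`, `P`, `Q` (`KFoldDet.kfoldWitness_dead_layout`).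
  With `|T| = ⌈log₂(h+1)⌉`: **no read-`k` determinant / read-`k` ABP with `k < √(h+1)/log₂(h+1)` (roughly)
  hits all partition minors**; `readK_det_eventually_dead`: for every fixed `k`, dead for all
  `h + 1 ≥ 2^{16(k+1)}` (crude block size `16(k+1)`, `readK_block_size`) — the cell's ROABP negative (`RoabpDoor.not_ROABPHitsPartitionMinors`:
  read-once, oblivious) extended to read-`k`, any order, any width.

WHAT THIS IS NOT: the dead layouts are hit by `SmallLayouts.partitionMinor_hit_of_card_le` (other
witnesses); nothing on item 19717 itself, crux stmt-ValiantsHypothesis-14610 or `VP ≠ VNP`.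
-/

set_option linter.dupNamespace false

open Matrix Finset MvPolynomial

namespace Summit.ValiantsHypothesis.ValiantsHypothesis.Theorems.BarrierLever.KFoldDet

noncomputable section

variable {h : ℕ}

/-! ## 1. A read-`k` determinant is a `k`-fold determinantal witness -/

/-- `Σ_v X_v · (P_v Q_v) = 𝐏 · diag(X) · 𝐐` with the `(h+h)·k` intermediate indices `(v, κ)`. -/
theorem sum_smul_lowRank_eq {m k : ℕ} (P : Fin (h + h) → Matrix (Fin m) (Fin k) ℂ)
    (Q : Fin (h + h) → Matrix (Fin k) (Fin m) ℂ) :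
    (∑ v : Fin (h + h), (X v : MvPolynomial (Fin (h + h)) ℂ) • ((P v * Q v).map MvPolynomial.C)) =
      (Matrix.of fun (i : Fin m) (p : Fin (h + h) × Fin k) =>
          (MvPolynomial.C (P p.1 i p.2) : MvPolynomial (Fin (h + h)) ℂ)) *
        Matrix.diagonal (fun p : Fin (h + h) × Fin k => (X p.1 : MvPolynomial (Fin (h + h)) ℂ)) *
        (Matrix.of fun (p : Fin (h + h) × Fin k) (j : Fin m) =>
          (MvPolynomial.C (Q p.1 p.2 j) : MvPolynomial (Fin (h + h)) ℂ)) := by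
  refine Matrix.ext fun i j => ?_
  calc (∑ v : Fin (h + h), (X v : MvPolynomial (Fin (h + h)) ℂ) • ((P v * Q v).map MvPolynomial.C)) i j
      = ∑ v : Fin (h + h), ∑ κ : Fin k, (X v : MvPolynomial (Fin (h + h)) ℂ) *
          (MvPolynomial.C (P v i κ) * MvPolynomial.C (Q v κ j)) := by
        rw [Matrix.sum_apply]
        refine Finset.sum_congr rfl fun v _ => ?_
        simp only [Matrix.smul_apply, Matrix.map_apply, Matrix.mul_apply, smul_eq_mul, map_sum, map_mul,
          Finset.mul_sum]
    _ = ∑ p : Fin (h + h) × Fin k, (X p.1 : MvPolynomial (Fin (h + h)) ℂ) *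
          (MvPolynomial.C (P p.1 i p.2) * MvPolynomial.C (Q p.1 p.2 j)) :=
        (Fintype.sum_prod_type' (fun (v : Fin (h + h)) (κ : Fin k) =>
          (X v : MvPolynomial (Fin (h + h)) ℂ) * (MvPolynomial.C (P v i κ) * MvPolynomial.C (Q v κ j)))).symm
    _ = _ := by
        rw [Matrix.mul_apply]
        refine Finset.sum_congr rfl fun p _ => ?_
        rw [Matrix.mul_diagonal, Matrix.of_apply, Matrix.of_apply]
        ring

/-- **Sylvester**: `det(1 + Σ_v X_v P_v Q_v) = det(1 + diag(X_{p.1}) · 𝐆)` with the `k`-fold table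
`𝐆_{p q} = Σ_j Q_{p.1}[p.2, j] · P_{q.1}[j, q.2]` on the indices `[h+h] × [k]`. -/
theorem readK_eq_kfold_prod {m k : ℕ} (P : Fin (h + h) → Matrix (Fin m) (Fin k) ℂ)
    (Q : Fin (h + h) → Matrix (Fin k) (Fin m) ℂ) :
    ((1 : Matrix (Fin m) (Fin m) (MvPolynomial (Fin (h + h)) ℂ)) +
        ∑ v : Fin (h + h), (X v : MvPolynomial (Fin (h + h)) ℂ) • ((P v * Q v).map MvPolynomial.C)).det =
      ((1 : Matrix (Fin (h + h) × Fin k) (Fin (h + h) × Fin k) (MvPolynomial (Fin (h + h)) ℂ)) +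
        Matrix.diagonal (fun p : Fin (h + h) × Fin k => (X p.1 : MvPolynomial (Fin (h + h)) ℂ)) *
          (Matrix.of fun p q : Fin (h + h) × Fin k => ∑ j : Fin m, Q p.1 p.2 j * P q.1 j q.2).map
            MvPolynomial.C).det := by
  rw [sum_smul_lowRank_eq, Matrix.mul_assoc, Matrix.det_one_add_mul_comm, Matrix.mul_assoc]
  have hG : (Matrix.of fun (p : Fin (h + h) × Fin k) (j : Fin m) =>
        (MvPolynomial.C (Q p.1 p.2 j) : MvPolynomial (Fin (h + h)) ℂ)) *
      (Matrix.of fun (i : Fin m) (p : Fin (h + h) × Fin k) =>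
        (MvPolynomial.C (P p.1 i p.2) : MvPolynomial (Fin (h + h)) ℂ)) =
      (Matrix.of fun p q : Fin (h + h) × Fin k => ∑ j : Fin m, Q p.1 p.2 j * P q.1 j q.2).map
        MvPolynomial.C := by
    refine Matrix.ext fun p q => ?_
    simp only [Matrix.mul_apply, Matrix.map_apply, Matrix.of_apply, map_sum, map_mul]
  rw [hG]

/-- The product-indexed `k`-fold determinant, re-indexed by `Fin N` through an equivalence, is the
`rename`-form `k`-fold witness of `…KFoldDetNoGo`. -/
theorem kfold_prod_eq_rename {k : ℕ} (Gp : Matrix (Fin (h + h) × Fin k) (Fin (h + h) × Fin k) ℂ)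
    (e : Fin (h + h) × Fin k ≃ Fin ((h + h) * k)) :
    ((1 : Matrix (Fin (h + h) × Fin k) (Fin (h + h) × Fin k) (MvPolynomial (Fin (h + h)) ℂ)) +
        Matrix.diagonal (fun p : Fin (h + h) × Fin k => (X p.1 : MvPolynomial (Fin (h + h)) ℂ)) *
          Gp.map MvPolynomial.C).det =
      rename (fun n : Fin ((h + h) * k) => (e.symm n).1)
        ((1 + Matrix.diagonal (fun i : Fin ((h + h) * k) => (X i : MvPolynomial (Fin ((h + h) * k)) ℂ)) *
          (Matrix.reindex e e Gp).map MvPolynomial.C).det) := by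
  rw [AlgHom.map_det, AlgHom.mapMatrix_apply, ← Matrix.det_reindex_self e]
  congr 1
  refine Matrix.ext fun n n' => ?_
  simp only [Matrix.reindex_apply, Matrix.submatrix_apply, Matrix.add_apply, Matrix.one_apply,
    Matrix.diagonal_mul, Matrix.map_apply, map_add, map_mul, rename_X, rename_C]
  by_cases hnn : n = n'
  · subst hnn; simp
  · have : e.symm n ≠ e.symm n' := fun heq => hnn (e.symm.injective heq)
    simp [hnn, this]

/-! ## 2. The dead layout for read-`k` determinants -/

/-- **NO-GO for read-`k` determinantal witnesses.** If `(k|T|)² + 1 < 2^|T| ≤ h + 1` for a block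
`T ⊆ Fin h`, one injective layout with `2^|T|` rows (of size `≤ 1`) and the subsets of `T` as columns
has a SINGULAR partition-minor layout matrix for every `f = det(1 + Σ_v X_v · P_v Q_v)`,
`P_v ∈ ℂ^{m×k}`, `Q_v ∈ ℂ^{k×m}`, whatever `m`. -/
theorem readK_det_dead_layout (k : ℕ) (T : Finset (Fin h))
    (hT : (k * T.card) * (k * T.card) + 1 < 2 ^ T.card) (hh : 2 ^ T.card ≤ h + 1) :
    ∃ u w : Fin (2 ^ T.card) → Finset (Fin h), Function.Injective u ∧ Function.Injective w ∧
      (∀ i, (u i).card ≤ 1) ∧ (∀ j, w j ⊆ T) ∧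
      ∀ (m : ℕ) (P : Fin (h + h) → Matrix (Fin m) (Fin k) ℂ) (Q : Fin (h + h) → Matrix (Fin k) (Fin m) ℂ),
        (Matrix.of fun i j : Fin (2 ^ T.card) => MvPolynomial.coeff
          (∑ a ∈ u i, Finsupp.single (Fin.castAdd h a) 1 +
            ∑ c ∈ w j, Finsupp.single (Fin.natAdd h c) 1)
          (((1 : Matrix (Fin m) (Fin m) (MvPolynomial (Fin (h + h)) ℂ)) +
            ∑ v : Fin (h + h), (X v : MvPolynomial (Fin (h + h)) ℂ) •
              ((P v * Q v).map MvPolynomial.C)).det)).det = 0 := by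
  classical
  obtain ⟨u, w, hu, hw, hu1, hwT, hdead⟩ := kfoldWitness_dead_layout (h := h) k T hT hh
  refine ⟨u, w, hu, hw, hu1, hwT, fun m P Q => ?_⟩
  set e : Fin (h + h) × Fin k ≃ Fin ((h + h) * k) := finProdFinEquiv with he
  set Gp : Matrix (Fin (h + h) × Fin k) (Fin (h + h) × Fin k) ℂ :=
    Matrix.of fun p q : Fin (h + h) × Fin k => ∑ j : Fin m, Q p.1 p.2 j * P q.1 j q.2 with hGp
  set π : Fin ((h + h) * k) → Fin (h + h) := fun n => (e.symm n).1 with hπ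
  have hfib : ∀ c ∈ T, (Finset.univ.filter (fun z : Fin ((h + h) * k) => π z = Fin.natAdd h c)).card ≤ k := by
    intro c _
    have heq : Finset.univ.filter (fun z : Fin ((h + h) * k) => π z = Fin.natAdd h c) =
        (Finset.univ.filter (fun p : Fin (h + h) × Fin k => p.1 = Fin.natAdd h c)).map e.toEmbedding := by
      ext z
      simp only [Finset.mem_filter, Finset.mem_univ, true_and, Finset.mem_map_equiv, hπ]
    rw [heq, Finset.card_map]
    have hset : Finset.univ.filter (fun p : Fin (h + h) × Fin k => p.1 = Fin.natAdd h c) =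
        ({Fin.natAdd h c} : Finset (Fin (h + h))) ×ˢ (Finset.univ : Finset (Fin k)) := by
      ext p
      simp only [Finset.mem_filter, Finset.mem_univ, true_and, and_true, Finset.mem_product,
        Finset.mem_singleton]
    rw [hset, Finset.card_product, Finset.card_singleton, Finset.card_univ, Fintype.card_fin, one_mul]
  have hwit : ((1 : Matrix (Fin m) (Fin m) (MvPolynomial (Fin (h + h)) ℂ)) +
        ∑ v : Fin (h + h), (X v : MvPolynomial (Fin (h + h)) ℂ) • ((P v * Q v).map MvPolynomial.C)).det =
      rename π ((1 + Matrix.diagonal (fun i : Fin ((h + h) * k) =>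
          (X i : MvPolynomial (Fin ((h + h) * k)) ℂ)) * (Matrix.reindex e e Gp).map MvPolynomial.C).det) := by
    rw [readK_eq_kfold_prod, ← hGp, kfold_prod_eq_rename Gp e]
  have hmat : (Matrix.of fun i j : Fin (2 ^ T.card) => MvPolynomial.coeff
        (∑ a ∈ u i, Finsupp.single (Fin.castAdd h a) 1 +
          ∑ c ∈ w j, Finsupp.single (Fin.natAdd h c) 1)
        (((1 : Matrix (Fin m) (Fin m) (MvPolynomial (Fin (h + h)) ℂ)) +
          ∑ v : Fin (h + h), (X v : MvPolynomial (Fin (h + h)) ℂ) •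
            ((P v * Q v).map MvPolynomial.C)).det)) =
      Matrix.of fun i j : Fin (2 ^ T.card) => MvPolynomial.coeff
        (∑ a ∈ u i, Finsupp.single (Fin.castAdd h a) 1 +
          ∑ c ∈ w j, Finsupp.single (Fin.natAdd h c) 1)
        (rename π ((1 + Matrix.diagonal (fun i : Fin ((h + h) * k) =>
          (X i : MvPolynomial (Fin ((h + h) * k)) ℂ)) * (Matrix.reindex e e Gp).map MvPolynomial.C).det)) := by
    ext i j
    rw [Matrix.of_apply, Matrix.of_apply, hwit]
  rw [hmat]
  exact hdead ((h + h) * k) (Matrix.reindex e e Gp) π hfib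

/-! ## 3. General invertible constant part (read-`k` ABPs verbatim) -/

/-- Absorbing an invertible constant part: `det(C + Σ_v X_v·P_v Q_v) = det C · det(1 + Σ_v X_v·(C⁻¹P_v) Q_v)`. -/
theorem det_readK_absorb {m k : ℕ} (Cm : Matrix (Fin m) (Fin m) ℂ) (hC : IsUnit Cm.det)
    (P : Fin (h + h) → Matrix (Fin m) (Fin k) ℂ) (Q : Fin (h + h) → Matrix (Fin k) (Fin m) ℂ) :
    (Cm.map MvPolynomial.C +
        ∑ v : Fin (h + h), (X v : MvPolynomial (Fin (h + h)) ℂ) • ((P v * Q v).map MvPolynomial.C)).det =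
      MvPolynomial.C Cm.det * ((1 : Matrix (Fin m) (Fin m) (MvPolynomial (Fin (h + h)) ℂ)) +
        ∑ v : Fin (h + h), (X v : MvPolynomial (Fin (h + h)) ℂ) •
          ((Cm⁻¹ * P v * Q v).map MvPolynomial.C)).det := by
  have hfac : Cm.map MvPolynomial.C +
      ∑ v : Fin (h + h), (X v : MvPolynomial (Fin (h + h)) ℂ) • ((P v * Q v).map MvPolynomial.C) =
      Cm.map MvPolynomial.C * ((1 : Matrix (Fin m) (Fin m) (MvPolynomial (Fin (h + h)) ℂ)) +
        ∑ v : Fin (h + h), (X v : MvPolynomial (Fin (h + h)) ℂ) •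
          ((Cm⁻¹ * P v * Q v).map MvPolynomial.C)) := by
    rw [Matrix.mul_add, Matrix.mul_one, Matrix.mul_sum]
    congr 1
    refine Finset.sum_congr rfl fun v _ => ?_
    rw [Matrix.mul_smul, ← Matrix.map_mul, ← Matrix.mul_assoc, ← Matrix.mul_assoc,
      Matrix.mul_nonsing_inv _ hC, Matrix.one_mul]
  rw [hfac, Matrix.det_mul, ← RingHom.mapMatrix_apply, ← RingHom.map_det]

/-- **NO-GO for read-`k` determinants with an invertible constant part** — the form delivered verbatim
by a read-`k` algebraic branching program (`C = 1 − N(0)` unipotent): the same dead layout. -/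
theorem readK_det_dead_layout' (k : ℕ) (T : Finset (Fin h))
    (hT : (k * T.card) * (k * T.card) + 1 < 2 ^ T.card) (hh : 2 ^ T.card ≤ h + 1) :
    ∃ u w : Fin (2 ^ T.card) → Finset (Fin h), Function.Injective u ∧ Function.Injective w ∧
      (∀ i, (u i).card ≤ 1) ∧ (∀ j, w j ⊆ T) ∧
      ∀ (m : ℕ) (Cm : Matrix (Fin m) (Fin m) ℂ), IsUnit Cm.det →
        ∀ (P : Fin (h + h) → Matrix (Fin m) (Fin k) ℂ) (Q : Fin (h + h) → Matrix (Fin k) (Fin m) ℂ),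
        (Matrix.of fun i j : Fin (2 ^ T.card) => MvPolynomial.coeff
          (∑ a ∈ u i, Finsupp.single (Fin.castAdd h a) 1 +
            ∑ c ∈ w j, Finsupp.single (Fin.natAdd h c) 1)
          ((Cm.map MvPolynomial.C +
            ∑ v : Fin (h + h), (X v : MvPolynomial (Fin (h + h)) ℂ) •
              ((P v * Q v).map MvPolynomial.C)).det)).det = 0 := by
  obtain ⟨u, w, hu, hw, hu1, hwT, hdead⟩ := readK_det_dead_layout (h := h) k T hT hh
  refine ⟨u, w, hu, hw, hu1, hwT, fun m Cm hC P Q => ?_⟩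
  have hmat : (Matrix.of fun i j : Fin (2 ^ T.card) => MvPolynomial.coeff
        (∑ a ∈ u i, Finsupp.single (Fin.castAdd h a) 1 +
          ∑ c ∈ w j, Finsupp.single (Fin.natAdd h c) 1)
        ((Cm.map MvPolynomial.C +
          ∑ v : Fin (h + h), (X v : MvPolynomial (Fin (h + h)) ℂ) •
            ((P v * Q v).map MvPolynomial.C)).det)) =
      Cm.det • (Matrix.of fun i j : Fin (2 ^ T.card) => MvPolynomial.coeff
        (∑ a ∈ u i, Finsupp.single (Fin.castAdd h a) 1 +
          ∑ c ∈ w j, Finsupp.single (Fin.natAdd h c) 1)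
        (((1 : Matrix (Fin m) (Fin m) (MvPolynomial (Fin (h + h)) ℂ)) +
          ∑ v : Fin (h + h), (X v : MvPolynomial (Fin (h + h)) ℂ) •
            (((Cm⁻¹ * P v) * Q v).map MvPolynomial.C)).det)) := by
    ext i j
    rw [Matrix.of_apply, Matrix.smul_apply, Matrix.of_apply, det_readK_absorb Cm hC P Q,
      MvPolynomial.coeff_C_mul, smul_eq_mul]
  rw [hmat, Matrix.det_smul, hdead m (fun v => Cm⁻¹ * P v) Q, mul_zero]

/-! ## 4. For every fixed `k`, read-`k` determinants are eventually dead -/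

/-- Arithmetic: `256 (n+1)⁴ + 1 < 65536^{n+1}`. -/
theorem pow4_lt_pow (n : ℕ) : 256 * (n + 1) ^ 4 + 1 < 65536 ^ (n + 1) := by
  induction n with
  | zero => norm_num
  | succ n ih =>
    have h3 : (n + 1 + 1) ^ 4 ≤ 16 * (n + 1) ^ 4 := by
      calc (n + 1 + 1) ^ 4 ≤ (2 * (n + 1)) ^ 4 := Nat.pow_le_pow_left (by omega) 4
        _ = 16 * (n + 1) ^ 4 := by ring
    have h4 : 256 * (n + 1 + 1) ^ 4 + 1 ≤ 65536 * (256 * (n + 1) ^ 4 + 1) := by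
      have := Nat.mul_le_mul_left 256 h3
      omega
    calc 256 * (n + 1 + 1) ^ 4 + 1 ≤ 65536 * (256 * (n + 1) ^ 4 + 1) := h4
      _ < 65536 * 65536 ^ (n + 1) := (Nat.mul_lt_mul_left (by norm_num)).mpr ih
      _ = 65536 ^ (n + 1 + 1) := by ring

/-- Arithmetic: with `t = 16(k+1)` one has `(k t)² + 1 < 2^t`. -/
theorem readK_block_size (k : ℕ) : (k * (16 * (k + 1))) * (k * (16 * (k + 1))) + 1 < 2 ^ (16 * (k + 1)) := by
  have h1 : k * (16 * (k + 1)) ≤ 16 * (k + 1) ^ 2 := by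
    have : k ≤ k + 1 := Nat.le_succ k
    calc k * (16 * (k + 1)) ≤ (k + 1) * (16 * (k + 1)) := Nat.mul_le_mul_right _ this
      _ = 16 * (k + 1) ^ 2 := by ring
  have h2 : (k * (16 * (k + 1))) * (k * (16 * (k + 1))) ≤ 256 * (k + 1) ^ 4 := by
    calc (k * (16 * (k + 1))) * (k * (16 * (k + 1))) ≤ (16 * (k + 1) ^ 2) * (16 * (k + 1) ^ 2) :=
          Nat.mul_le_mul h1 h1
      _ = 256 * (k + 1) ^ 4 := by ring
  have h3 : (2 : ℕ) ^ (16 * (k + 1)) = 65536 ^ (k + 1) := by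
    rw [pow_mul]; norm_num
  rw [h3]
  exact lt_of_le_of_lt (Nat.add_le_add_right h2 1) (pow4_lt_pow k)

/-- **Read-`k` determinants are eventually dead, for every fixed `k`.** For `h + 1 ≥ 2^{16(k+1)}` some
injective layout (of size `2^{16(k+1)}`) is missed by every read-`k` determinantal witness
`det(C + Σ_v X_v · P_v Q_v)` (`C` invertible, `P_v ∈ ℂ^{m×k}`, `Q_v ∈ ℂ^{k×m}`, any `m`). -/
theorem readK_det_eventually_dead (k : ℕ) {h : ℕ} (hh : 2 ^ (16 * (k + 1)) ≤ h + 1) :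
    ∃ (r : ℕ) (u w : Fin r → Finset (Fin h)), Function.Injective u ∧ Function.Injective w ∧
      ∀ (m : ℕ) (Cm : Matrix (Fin m) (Fin m) ℂ), IsUnit Cm.det →
        ∀ (P : Fin (h + h) → Matrix (Fin m) (Fin k) ℂ) (Q : Fin (h + h) → Matrix (Fin k) (Fin m) ℂ),
        (Matrix.of fun i j : Fin r => MvPolynomial.coeff
          (∑ a ∈ u i, Finsupp.single (Fin.castAdd h a) 1 +
            ∑ c ∈ w j, Finsupp.single (Fin.natAdd h c) 1)
          ((Cm.map MvPolynomial.C +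
            ∑ v : Fin (h + h), (X v : MvPolynomial (Fin (h + h)) ℂ) •
              ((P v * Q v).map MvPolynomial.C)).det)).det = 0 := by
  classical
  -- a block `T` of `16(k+1)` coordinates exists inside `Fin h`
  have ht : 16 * (k + 1) ≤ h := by
    have : 16 * (k + 1) < 2 ^ (16 * (k + 1)) := Nat.lt_two_pow_self
    omega
  obtain ⟨T, -, hTcard⟩ := Finset.exists_subset_card_eq
    (show 16 * (k + 1) ≤ (Finset.univ : Finset (Fin h)).card by
      rw [Finset.card_univ, Fintype.card_fin]; exact ht)
  have hT : (k * T.card) * (k * T.card) + 1 < 2 ^ T.card := by rw [hTcard]; exact readK_block_size k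
  have hhT : 2 ^ T.card ≤ h + 1 := by rw [hTcard]; exact hh
  obtain ⟨u, w, hu, hw, -, -, hdead⟩ := readK_det_dead_layout' (h := h) k T hT hhT
  exact ⟨2 ^ T.card, u, w, hu, hw, hdead⟩

end

end Summit.ValiantsHypothesis.ValiantsHypothesis.Theorems.BarrierLever.KFoldDet
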